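import Summits.CriticalPhenomena.PercolationContinuityZ3.Theorems.PercNearOneGluingNoHeavyLowerTailAntitheticTransport
import HarnessLib

/-!
# `NoHeavyLowerTail` (stmt-CriticalPhenomena-4575) — antithetic cluster pairs: TRANSPORT of shifted-BIC ((⊕)_shift / (M)_shift)
# statements along a vertex embedding (prim-hp-2 gen 66, HOME/MEMO-gen66.md §1)

Support file (`--supports stmt-CriticalPhenomena-4575`, hull-port prover `prim-hp-2`, gen 66).  No definitions, no named facts, no sorries;
standard axioms.  The `𝒮_shift` companion of …AntitheticTransport: the re-based handle machinery (…AntitheticHandleDualShift) consumes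
(⊕)_shift / (M)_shift in COLOURING FORM over an arbitrary finite vertex type `V` and for all monotone nested `F⁻ ≤ F⁺`, `G⁻ ≤ G⁺ : Set V → ℝ`;
the kernel decisions (…AntitheticShiftDecide and its instance files) produce them in POWERSET FORM on a concrete `Fin k`.  The bridge is the
one of …AntitheticTransport verbatim (pull the four set functions back along `φ` — pull-backs of monotone nested pairs are monotone nested
pairs —, reindex the powerset, pass to all colourings by `Antithetic.sum_filter_inter_nonneg`):
* `Antithetic.TransportShift.event_sum_of_powerset` — generic event; `oplus_of_powerset` (event `y ∈ X`), `mixed_of_powerset`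
  (event `y ∈ X ∧ z ∉ Y`).
[cite: VandenbergHaggstromKahn2005, §1 p. 6 ("Harris' inequality"), §1 p. 3 (open cluster `C_s`)]
-/

noncomputable section

namespace Summit.CriticalPhenomena.PercolationContinuityZ3.Theorems

open Literature.Probability.Percolation
open scoped Classical

namespace Antithetic

namespace TransportShift

variable {V₀ V : Type*} {φ : V₀ → V} (hφ : Function.Injective φ)
include hφ

variable [Fintype V] (E₁ : Finset (Sym2 V₀)) (s₀ : V₀)

/-- **Generic transport, shifted-BIC class.**  `ev₀` an event on pairs of `V₀`-sets, `ev` an event on pairs of `V`-sets with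
`ev (φ '' A) (φ '' B) ↔ ev₀ A B`.  If `Σ_{θ ⊆ E₁, ev₀} (F⁺(C(θ)) − F⁻(C(E₁∖θ)))·(G⁺(C(θ)) − G⁻(C(E₁∖θ))) ≥ 0` for all monotone nested
`F⁻ ≤ F⁺`, `G⁻ ≤ G⁺` on `V₀` (powerset form), then for the image edge set `E = Sym2.map φ '' E₁` in `V` the colouring-form statement holds for
all monotone nested pairs on `V`. [this work] -/
theorem event_sum_of_powerset (ev₀ : Set V₀ → Set V₀ → Prop) (ev : Set V → Set V → Prop)
    (hev : ∀ A B : Set V₀, ev (φ '' A) (φ '' B) ↔ ev₀ A B)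
    (hcert : ∀ Fp Fm Gp Gm : Set V₀ → ℝ, Monotone Fp → Monotone Fm → (∀ S, Fm S ≤ Fp S) →
      Monotone Gp → Monotone Gm → (∀ S, Gm S ≤ Gp S) →
      0 ≤ ∑ θ ∈ E₁.powerset.filter (fun θ : Finset (Sym2 V₀) =>
          ev₀ (openCluster (↑θ : Set (Sym2 V₀)) s₀) (openCluster (↑(E₁ \ θ) : Set (Sym2 V₀)) s₀)),
        (Fp (openCluster (↑θ : Set (Sym2 V₀)) s₀) - Fm (openCluster (↑(E₁ \ θ) : Set (Sym2 V₀)) s₀)) *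
          (Gp (openCluster (↑θ : Set (Sym2 V₀)) s₀) - Gm (openCluster (↑(E₁ \ θ) : Set (Sym2 V₀)) s₀)))
    {E : Set (Sym2 V)} (hE : E = Sym2.map φ '' ↑E₁)
    (Fp Fm Gp Gm : Set V → ℝ) (hFp : Monotone Fp) (hFm : Monotone Fm) (hF : ∀ S, Fm S ≤ Fp S)
    (hGp : Monotone Gp) (hGm : Monotone Gm) (hG : ∀ S, Gm S ≤ Gp S) :
    0 ≤ ∑ T ∈ Finset.univ.filter (fun T : Set (Sym2 V) =>
        ev (openCluster (T ∩ E) (φ s₀)) (openCluster (Tᶜ ∩ E) (φ s₀))),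
      (Fp (openCluster (T ∩ E) (φ s₀)) - Fm (openCluster (Tᶜ ∩ E) (φ s₀))) *
        (Gp (openCluster (T ∩ E) (φ s₀)) - Gm (openCluster (Tᶜ ∩ E) (φ s₀))) := by
  have hφ' : Function.Injective (Sym2.map φ) := Sym2.map.injective hφ
  -- pull back the four set functions
  let Lp : Set V₀ → ℝ := fun A => Fp (φ '' A)
  let Lm : Set V₀ → ℝ := fun A => Fm (φ '' A)
  let Mp : Set V₀ → ℝ := fun A => Gp (φ '' A)
  let Mm : Set V₀ → ℝ := fun A => Gm (φ '' A)
  have hmono : ∀ {F : Set V → ℝ}, Monotone F → Monotone (fun A : Set V₀ => F (φ '' A)) :=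
    fun hF' A A' hA => hF' (Set.image_mono hA)
  have hpos := hcert Lp Lm Mp Mm (hmono hFp) (hmono hFm) (fun S => hF _) (hmono hGp) (hmono hGm) (fun S => hG _)
  -- from colourings to sub-configurations of `E`
  have hc : ∀ T : Set (Sym2 V), Tᶜ ∩ E = E \ (T ∩ E) := fun T => compl_inter_eq_diff T E
  simp_rw [hc]
  refine sum_filter_inter_nonneg E (fun η => ev (openCluster η (φ s₀)) (openCluster (E \ η) (φ s₀)))
    (fun η => (Fp (openCluster η (φ s₀)) - Fm (openCluster (E \ η) (φ s₀))) *
      (Gp (openCluster η (φ s₀)) - Gm (openCluster (E \ η) (φ s₀)))) ?_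
  -- reindex the sub-configurations of `E` by those of `E₁`
  let ι : Finset (Sym2 V₀) → Set (Sym2 V) := fun θ => Sym2.map φ '' ↑θ
  have hιinj : Function.Injective ι := fun θ₁ θ₂ h => Finset.coe_injective ((Set.image_injective.2 hφ') h)
  have hclus : ∀ θ : Finset (Sym2 V₀), openCluster (ι θ) (φ s₀) = φ '' openCluster (↑θ : Set (Sym2 V₀)) s₀ :=
    fun θ => Transport.cluster_image hφ _ s₀
  have hdiff : ∀ θ : Finset (Sym2 V₀), θ ⊆ E₁ → E \ ι θ = ι (E₁ \ θ) := by
    intro θ _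
    show E \ Sym2.map φ '' ↑θ = Sym2.map φ '' ↑(E₁ \ θ)
    rw [hE, Finset.coe_sdiff, Set.image_sdiff hφ']
  have hset : (Finset.univ.filter fun η : Set (Sym2 V) => η ⊆ E).filter
        (fun η => ev (openCluster η (φ s₀)) (openCluster (E \ η) (φ s₀))) =
      (E₁.powerset.filter (fun θ : Finset (Sym2 V₀) =>
          ev₀ (openCluster (↑θ : Set (Sym2 V₀)) s₀) (openCluster (↑(E₁ \ θ) : Set (Sym2 V₀)) s₀))).image ι := by
    ext η
    simp only [Finset.mem_filter, Finset.mem_univ, true_and, Finset.mem_image, Finset.mem_powerset]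
    constructor
    · rintro ⟨hsub, hp⟩
      let θ : Finset (Sym2 V₀) := E₁.filter fun e => Sym2.map φ e ∈ η
      have hθ : ι θ = η := by
        ext f
        simp only [ι, θ, Finset.coe_filter, Set.mem_image, Set.mem_setOf_eq]
        constructor
        · rintro ⟨e, ⟨-, he⟩, rfl⟩; exact he
        · intro hf
          have hfE : f ∈ E := hsub hf
          rw [hE] at hfE
          obtain ⟨e, he, rfl⟩ := hfE
          exact ⟨e, ⟨he, hf⟩, rfl⟩
      refine ⟨θ, ⟨⟨Finset.filter_subset _ _, ?_⟩, hθ⟩⟩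
      rw [← hev, ← hclus θ, ← hclus (E₁ \ θ), ← hdiff θ (Finset.filter_subset _ _), hθ]
      exact hp
    · rintro ⟨θ, ⟨hθ, hp⟩, rfl⟩
      refine ⟨?_, ?_⟩
      · show Sym2.map φ '' ↑θ ⊆ E
        rw [hE]; exact Set.image_mono (Finset.coe_subset.2 hθ)
      · rw [hdiff θ hθ, hclus θ, hclus (E₁ \ θ), hev]
        exact hp
  rw [hset, Finset.sum_image (fun θ₁ _ θ₂ _ h => hιinj h)]
  refine le_of_le_of_eq hpos (Finset.sum_congr rfl fun θ hθ => ?_)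
  have hθE : θ ⊆ E₁ := Finset.mem_powerset.1 (Finset.mem_filter.1 hθ).1
  simp only [Lp, Lm, Mp, Mm]
  rw [hdiff θ hθE, hclus θ, hclus (E₁ \ θ)]

/-- **Transport of (⊕)_shift** (event `y ∈ X`). [this work] -/
theorem oplus_of_powerset (y₀ : V₀)
    (hcert : ∀ Fp Fm Gp Gm : Set V₀ → ℝ, Monotone Fp → Monotone Fm → (∀ S, Fm S ≤ Fp S) →
      Monotone Gp → Monotone Gm → (∀ S, Gm S ≤ Gp S) →
      0 ≤ ∑ θ ∈ E₁.powerset.filter (fun θ : Finset (Sym2 V₀) =>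
          (SimpleGraph.fromEdgeSet (↑θ : Set (Sym2 V₀))).Reachable s₀ y₀),
        (Fp (openCluster (↑θ : Set (Sym2 V₀)) s₀) - Fm (openCluster (↑(E₁ \ θ) : Set (Sym2 V₀)) s₀)) *
          (Gp (openCluster (↑θ : Set (Sym2 V₀)) s₀) - Gm (openCluster (↑(E₁ \ θ) : Set (Sym2 V₀)) s₀)))
    {E : Set (Sym2 V)} (hE : E = Sym2.map φ '' ↑E₁)
    (Fp Fm Gp Gm : Set V → ℝ) (hFp : Monotone Fp) (hFm : Monotone Fm) (hF : ∀ S, Fm S ≤ Fp S)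
    (hGp : Monotone Gp) (hGm : Monotone Gm) (hG : ∀ S, Gm S ≤ Gp S) :
    0 ≤ ∑ T ∈ Finset.univ.filter (fun T : Set (Sym2 V) => φ y₀ ∈ openCluster (T ∩ E) (φ s₀)),
      (Fp (openCluster (T ∩ E) (φ s₀)) - Fm (openCluster (Tᶜ ∩ E) (φ s₀))) *
        (Gp (openCluster (T ∩ E) (φ s₀)) - Gm (openCluster (Tᶜ ∩ E) (φ s₀))) := by
  have h := event_sum_of_powerset hφ E₁ s₀ (fun A _ => y₀ ∈ A) (fun A _ => φ y₀ ∈ A) (fun A B => hφ.mem_set_image) ?_ hE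
    Fp Fm Gp Gm hFp hFm hF hGp hGm hG
  · convert h using 3
  · intro Lp Lm Mp Mm hLp hLm hL hMp hMm hM
    have h' := hcert Lp Lm Mp Mm hLp hLm hL hMp hMm hM
    convert h' using 3
    unfold openCluster openGraph; exact Iff.rfl

/-- **Transport of (M)_shift** (event `y ∈ X ∧ z ∉ Y`). [this work] -/
theorem mixed_of_powerset (y₀ z₀ : V₀)
    (hcert : ∀ Fp Fm Gp Gm : Set V₀ → ℝ, Monotone Fp → Monotone Fm → (∀ S, Fm S ≤ Fp S) →
      Monotone Gp → Monotone Gm → (∀ S, Gm S ≤ Gp S) →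
      0 ≤ ∑ θ ∈ E₁.powerset.filter (fun θ : Finset (Sym2 V₀) =>
          (SimpleGraph.fromEdgeSet (↑θ : Set (Sym2 V₀))).Reachable s₀ y₀ ∧
            ¬ (SimpleGraph.fromEdgeSet (↑(E₁ \ θ) : Set (Sym2 V₀))).Reachable s₀ z₀),
        (Fp (openCluster (↑θ : Set (Sym2 V₀)) s₀) - Fm (openCluster (↑(E₁ \ θ) : Set (Sym2 V₀)) s₀)) *
          (Gp (openCluster (↑θ : Set (Sym2 V₀)) s₀) - Gm (openCluster (↑(E₁ \ θ) : Set (Sym2 V₀)) s₀)))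
    {E : Set (Sym2 V)} (hE : E = Sym2.map φ '' ↑E₁)
    (Fp Fm Gp Gm : Set V → ℝ) (hFp : Monotone Fp) (hFm : Monotone Fm) (hF : ∀ S, Fm S ≤ Fp S)
    (hGp : Monotone Gp) (hGm : Monotone Gm) (hG : ∀ S, Gm S ≤ Gp S) :
    0 ≤ ∑ T ∈ Finset.univ.filter (fun T : Set (Sym2 V) =>
        φ y₀ ∈ openCluster (T ∩ E) (φ s₀) ∧ φ z₀ ∉ openCluster (Tᶜ ∩ E) (φ s₀)),
      (Fp (openCluster (T ∩ E) (φ s₀)) - Fm (openCluster (Tᶜ ∩ E) (φ s₀))) *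
        (Gp (openCluster (T ∩ E) (φ s₀)) - Gm (openCluster (Tᶜ ∩ E) (φ s₀))) := by
  have h := event_sum_of_powerset hφ E₁ s₀ (fun A B => y₀ ∈ A ∧ z₀ ∉ B) (fun A B => φ y₀ ∈ A ∧ φ z₀ ∉ B)
    (fun A B => by rw [hφ.mem_set_image, hφ.mem_set_image]) ?_ hE Fp Fm Gp Gm hFp hFm hF hGp hGm hG
  · convert h using 3
  · intro Lp Lm Mp Mm hLp hLm hL hMp hMm hM
    have h' := hcert Lp Lm Mp Mm hLp hLm hL hMp hMm hM
    convert h' using 3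
    unfold openCluster openGraph; exact Iff.rfl

end TransportShift

end Antithetic

end Summit.CriticalPhenomena.PercolationContinuityZ3.Theorems
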